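import Summits.BirchSwinnertonDyer.BirchSwinnertonDyer.Theorems.ManinLocalTwoThreeSplitFiveCyclotomicSieve
import HarnessLib

/-!
# Manin `c = ±1`, local two/three programme — Lemma A1 of the cyclotomic sieve WITHOUT the side
# hypothesis `q ≠ 2` (T-es-99; answer to ref1 §R264 R-es-45 (a))

Cell `bsd-f2-manin`, es lens (gen 45), `--supports stmt-BirchSwinnertonDyer-22967` (crux C2 `ManinOddAtFour`),
helper of the landed `…Theorems.ManinLocalTwoThreeSplitFiveCyclotomicSieve` (p778819, T-es-96).

The landed Lemma A1 `ShimuraFive.not_prime_dvd_splitFiveOctic` carries `h2 : q ≠ 2`.  It is inert: `Q₈(x, 1)` has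
no root in `𝔽₂` either (`Q₈(0,1) = 1`, `Q₈(1,1) = 11`), so for coprime `U, V` the octic `Q₈(U,V)` is odd.  This file
records the `q = 2` case (`not_two_dvd_splitFiveOctic`) and the public form of A1 with `h2` dropped
(`not_prime_dvd_splitFiveOctic'`): **every prime factor `q ≠ 5` of `Q₈(U,V)`, `gcd(U,V) = 1`, is `≡ 1 (mod 5)`.**
In the landed consumer (`…ShimuraFiveSquarefreeHolds`, T-es-98) `h2` is discharged by `omega` at the call site
(`q ≡ 4 (mod 5)` there), so nothing upstream changes; this is hygiene for future users of A1.

HONEST FRAMING: elementary arithmetic of the binary octic `Q₈`; unconditional; no definition, no named fact, no sorry.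
Nothing here is a statement about `c_E`; C2, Manin's conjecture and BSD are not proved by this.
[cite: ByeonKim2014, Lemma 2.2] [this file; MEMO-es §69.1]
-/

set_option autoImplicit false
-- lint-debt: the directory name repeats the summit name (sibling precedent `ManinLocalTwoThreeSplitFiveCyclotomicSieve.lean`)
set_option linter.dupNamespace false

namespace Summit.BirchSwinnertonDyer.BirchSwinnertonDyer.Theorems.ManinLocalTwoThree.ShimuraFive

/-- `Q₈(x, 1) ≠ 0` on `𝔽₂` (both values are `1`). [this file] -/
theorem splitFiveOctic_zmod_two_ne_zero (x : ZMod 2) : splitFiveOctic x 1 ≠ 0 := by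
  unfold splitFiveOctic; decide +revert

/-- `Q₈(a, b) = 0` on `𝔽₂` forces `a = b = 0`. [this file] -/
theorem splitFiveOctic_zmod_two_eq_zero_iff (a b : ZMod 2) : splitFiveOctic a b = 0 ↔ a = 0 ∧ b = 0 := by
  unfold splitFiveOctic; decide +revert

/-- **The prime `2` never divides `Q₈(U,V)` for coprime `U, V`.** [this file; MEMO-es §69.1] -/
theorem not_two_dvd_splitFiveOctic {U V : ℤ} (hUV : IsCoprime U V) : ¬ (2 : ℤ) ∣ splitFiveOctic U V := by
  intro hdvd
  have hz : splitFiveOctic (U : ZMod 2) (V : ZMod 2) = 0 := by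
    rw [← cast_splitFiveOctic]; exact (ZMod.intCast_zmod_eq_zero_iff_dvd _ 2).mpr hdvd
  obtain ⟨hU, hV⟩ := (splitFiveOctic_zmod_two_eq_zero_iff _ _).mp hz
  have hqU : (2 : ℤ) ∣ U := (ZMod.intCast_zmod_eq_zero_iff_dvd U 2).mp hU
  have hqV : (2 : ℤ) ∣ V := (ZMod.intCast_zmod_eq_zero_iff_dvd V 2).mp hV
  have hunit : IsUnit (2 : ℤ) := hUV.isUnit_of_dvd' hqU hqV
  rw [Int.isUnit_iff] at hunit
  omega

/-- **Lemma A1, public form (no `q ≠ 2`).** For coprime integers `U, V` and a prime `q ≠ 5` with `5 ∤ q − 1`,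
`q ∤ Q₈(U,V)`: every prime factor `≠ 5` of `Q₈(U,V)` is `≡ 1 (mod 5)`. [cite: ByeonKim2014, Lemma 2.2] [this file; MEMO-es §69.1] -/
theorem not_prime_dvd_splitFiveOctic' {U V : ℤ} (hUV : IsCoprime U V) {q : ℕ} (hq : q.Prime)
    (h5 : q ≠ 5) (hq1 : ¬ 5 ∣ q - 1) : ¬ (q : ℤ) ∣ splitFiveOctic U V := by
  by_cases h2 : q = 2
  · subst h2; exact_mod_cast not_two_dvd_splitFiveOctic hUV
  · exact not_prime_dvd_splitFiveOctic hUV hq h2 h5 hq1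

end Summit.BirchSwinnertonDyer.BirchSwinnertonDyer.Theorems.ManinLocalTwoThree.ShimuraFive
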